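import Literature.AlgebraicGeometry.Frobenioids.PerfFactorialSplitting
import HarnessLib

/-!
# Frobenioids I, Definition 2.4 (i): supports and primary factorizations — the monoid statements
# of Proposition 4.1 (iii), (iv), (v)

Mochizuki, *The geometry of Frobenioids I: the general theory*, Kyushu J. Math. **62** (2008)
293–400, §2 Definition 2.4 (i)(c)(d) (kurims pp. 47–48) and the proof of Proposition 4.1
(iii)–(v) (pp. 76–77) [cite: MochizukiFrdI2008, Prop. 4.1 (iii) p.76].

For a perfect perf-factorial monoid `M` (in Prop. 4.1, `M = Φ(A)`, perfect by Prop. 1.10 (iii)),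
through the factorization homomorphism of Def. 2.4 (i)(c) on `M^pf ≅ M`:
* (iii) "`x_ε, x_ι` have disjoint supports" iff "every `x_ζ` such that `x_ζ ≤ x_ε`, `x_ζ ≤ x_ι` is,
  in fact, equal to `0`" (`forall_common_dvd_eq_one_iff_disjoint_supp`), and then "`x_ε + x_ι ≤ x_U`
  if and only if `x_ε ≤ x_U`, `x_ι ≤ x_U`" (`mul_dvd_of_forall_common_dvd_eq_one`) — "by
  considering the primary factorizations of `x_ε, x_ι`" (p. 77);
* (iv)/(v) "for every primary element `x_ε' ∉ 𝔭`, `x_ε' ≤ x_ε` if and only if `x_ε' ≤ x_δ + x_ε`"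
  for some prime `𝔭` iff `x_δ` is primary (`isPrimary_iff_exists_prime_dvd_iff`) — "by comparing
  the primary factorizations of `x_ε`, `x_δ + x_ε`" (p. 77).
Multiplicative notation as in `Monoids.lean`; `Supp` is `supp ∘ factorMap` of Def. 2.4 (i)(d) on the
image in `M^pf`. No new definitions.
-/

namespace Literature.AlgebraicGeometry.Frobenioids

open Function

universe u

variable {M : Type u} [CommMonoid M]

/-! ### Helpers on the factorization homomorphism -/

/-- `Supp` is monotone for divisibility. [cite: MochizukiFrdI2008, Def. 2.4(i) p.48] -/
theorem IsPerfFactorial.supp_factorMap_subset_of_dvd (h : IsPerfFactorial M) {a b : Perfection M}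
    (hab : a ∣ b) : supp (factorMap M a) ⊆ supp (factorMap M b) := by
  obtain ⟨c, rfl⟩ := hab
  rw [h.factorMap_mul]
  exact supp_subset_supp_mul _ _

/-- A non-zero element has a non-zero factorization. [cite: MochizukiFrdI2008, Def. 2.4(i) p.47] -/
theorem IsPerfFactorial.exists_factorMap_apply_ne_one (h : IsPerfFactorial M) {y : Perfection M}
    (hy : y ≠ 1) : ∃ 𝔮 : Primes (Perfection M), factorMap M y 𝔮 ≠ 1 := by
  by_contra hc
  push Not at hc
  exact hy (h.factorMap_injective ((funext hc).trans h.factorMap_one.symm))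

/-- A non-zero element supported at the single prime `𝔮` belongs to `𝔮` (it is `≼ p` for `p ∈ 𝔮`).
[cite: MochizukiFrdI2008, Def. 2.4(i) p.47] -/
theorem IsPerfFactorial.mem_carrier_of_factorMap_eq_mulSingle (h : IsPerfFactorial M)
    {𝔮 : Primes (Perfection M)} {y₁ : Perfection M} (x₁ : PfAt M 𝔮)
    (hy₁ : haveI := Classical.decEq (Primes (Perfection M));
      factorMap M y₁ = pfFactorToRlfFactor M (Pi.mulSingle 𝔮 x₁)) (hy1 : y₁ ≠ 1) :
    y₁ ∈ 𝔮.carrier := by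
  obtain ⟨⟨p, hp'⟩, hp⟩ := Quotient.exists_rep 𝔮
  have hpc : p ∈ 𝔮.carrier := ⟨hp', hp⟩
  exact 𝔮.mem_carrier_of_precsim hpc hy1 (h.precsim_of_factorMap_eq_mulSingle hpc x₁ hy₁)

/-- Coordinates of a splitting `y = y₁ + y₂` at `𝔮` (as produced by `exists_split`): off `𝔮`, the
coordinates of `y` are those of `y₂`. [cite: MochizukiFrdI2008, Def. 2.4(i) p.47] -/
theorem IsPerfFactorial.factorMap_apply_of_split_ne (h : IsPerfFactorial M)
    {𝔮 𝔮' : Primes (Perfection M)} {y y₁ y₂ : Perfection M} (x₁ : PfAt M 𝔮) (hy : y₁ * y₂ = y)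
    (hy₁ : haveI := Classical.decEq (Primes (Perfection M));
      factorMap M y₁ = pfFactorToRlfFactor M (Pi.mulSingle 𝔮 x₁)) (hne : 𝔮' ≠ 𝔮) :
    factorMap M y 𝔮' = factorMap M y₂ 𝔮' := by
  classical
  rw [← hy, h.factorMap_mul, Pi.mul_apply, hy₁, pfFactorToRlfFactor_apply, Pi.mulSingle_eq_of_ne hne,
    map_one, one_mul]

/-- Coordinates of a splitting `y = y₁ + y₂` at `𝔮`: at `𝔮`, the coordinate of `y` is that of `y₁`.
[cite: MochizukiFrdI2008, Def. 2.4(i) p.47] -/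
theorem IsPerfFactorial.factorMap_apply_of_split_same (h : IsPerfFactorial M)
    {𝔮 : Primes (Perfection M)} {y y₁ y₂ : Perfection M} (hy : y₁ * y₂ = y)
    (hy₂ : factorMap M y₂ 𝔮 = 1) : factorMap M y 𝔮 = factorMap M y₁ 𝔮 := by
  rw [← hy, h.factorMap_mul, Pi.mul_apply, hy₂, mul_one]

section Perfect

/-- For perfect `M`, divisibility is detected in `M^pf`. [cite: MochizukiFrdI2008, §0 p.11] -/
theorem Perfection.of_dvd_of_iff (hbij : Bijective (Perfection.of M)) {u v : M} :
    Perfection.of M u ∣ Perfection.of M v ↔ u ∣ v := by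
  refine ⟨fun ⟨w, hw⟩ => ?_, map_dvd _⟩
  obtain ⟨W, rfl⟩ := hbij.2 w
  exact ⟨W, hbij.1 (by rw [map_mul, hw])⟩

/-! ### Proposition 4.1 (iii), the monoid statements -/

/-- **Proposition 4.1 (iii) in the language of monoids**, the criterion (FrdI pp. 76–77): in a perfect
perf-factorial monoid, "every `x` such that `x ≤ a`, `x ≤ b` is, in fact, equal to `0`" iff `a`,
`b` have disjoint supports ("by considering the primary factorizations of `x_ε, x_ι`", Def. 2.4
(i)(c)(d)). [cite: MochizukiFrdI2008, Prop. 4.1 (iii) p.76] -/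
theorem IsPerfFactorial.forall_common_dvd_eq_one_iff_disjoint_supp (h : IsPerfFactorial M)
    (hperf : IsPerfect M) (a b : M) :
    (∀ x : M, x ∣ a → x ∣ b → x = 1) ↔
      Disjoint (supp (factorMap M (Perfection.of M a))) (supp (factorMap M (Perfection.of M b))) := by
  have hM : IsSharp M := h.isDivisorial.isSharp
  have hbij := isPerfect_iff_bijective_of.mp hperf
  rw [Set.disjoint_left]
  constructor
  · intro hno 𝔮 h𝔮a h𝔮b
    obtain ⟨a₁, a₂, xa, ha, ha₁, ha₂⟩ := h.exists_split (Perfection.of M a) 𝔮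
    obtain ⟨b₁, b₂, xb, hb, hb₁, hb₂⟩ := h.exists_split (Perfection.of M b) 𝔮
    have ha₁1 : a₁ ≠ 1 := by
      intro e
      apply h𝔮a
      show factorMap M (Perfection.of M a) 𝔮 = 1
      rw [h.factorMap_apply_of_split_same ha ha₂, e, h.factorMap_one]; rfl
    have hb₁1 : b₁ ≠ 1 := by
      intro e
      apply h𝔮b
      show factorMap M (Perfection.of M b) 𝔮 = 1
      rw [h.factorMap_apply_of_split_same hb hb₂, e, h.factorMap_one]; rfl
    have ha₁c := h.mem_carrier_of_factorMap_eq_mulSingle xa ha₁ ha₁1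
    have hb₁c := h.mem_carrier_of_factorMap_eq_mulSingle xb hb₁ hb₁1
    obtain ⟨A₁, rfl⟩ := hbij.2 a₁
    obtain ⟨B₁, rfl⟩ := hbij.2 b₁
    have hA₁prim : IsPrimary A₁ := (Perfection.isPrimary_of_iff hM).mp ha₁c.1
    have hB₁1 : B₁ ≠ 1 := fun e => hb₁1 (by rw [e, map_one])
    let 𝔭 : Primes M := Quotient.mk (primarySetoid M) ⟨A₁, hA₁prim⟩
    have hA₁𝔭 : A₁ ∈ 𝔭.carrier := mem_carrier_mk_of_isPrimary hA₁prim
    have hB₁𝔭 : B₁ ∈ 𝔭.carrier := 𝔭.mem_carrier_of_precsim hA₁𝔭 hB₁1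
      (Perfection.of_precsim_of_iff.mp (𝔮.precsim_of_mem_carrier hb₁c ha₁c))
    have hA₁a : A₁ ∣ a := (Perfection.of_dvd_of_iff hbij).mp (Dvd.intro _ ha)
    have hB₁b : B₁ ∣ b := (Perfection.of_dvd_of_iff hbij).mp (Dvd.intro _ hb)
    rcases h.dvd_total_of_mem_submonoid 𝔭 (Submonoid.subset_closure hA₁𝔭)
      (Submonoid.subset_closure hB₁𝔭) with h1 | h1
    · exact hA₁prim.1 (hno A₁ hA₁a (h1.trans hB₁b))
    · exact hB₁1 (hno B₁ (h1.trans hA₁a) hB₁b)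
  · intro hdis x hxa hxb
    by_contra hx1
    have hx1' : Perfection.of M x ≠ 1 := fun e => hx1 (hbij.1 (by rw [e, map_one]))
    obtain ⟨𝔮, h𝔮⟩ := h.exists_factorMap_apply_ne_one hx1'
    exact hdis (h.supp_factorMap_subset_of_dvd (map_dvd _ hxa) h𝔮)
      (h.supp_factorMap_subset_of_dvd (map_dvd _ hxb) h𝔮)

/-- **Proposition 4.1 (iii) in the language of monoids**, the displayed property (FrdI p. 77): in a
perfect perf-factorial monoid, if no non-zero `x` satisfies `x ≤ a`, `x ≤ b`, then "`a + b ≤ c` if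
and only if `a ≤ c`, `b ≤ c`" (the non-trivial direction). [cite: MochizukiFrdI2008, Prop. 4.1 (iii) p.77] -/
theorem IsPerfFactorial.mul_dvd_of_forall_common_dvd_eq_one (h : IsPerfFactorial M)
    (hperf : IsPerfect M) {a b c : M} (hno : ∀ x : M, x ∣ a → x ∣ b → x = 1) (hac : a ∣ c)
    (hbc : b ∣ c) : a * b ∣ c := by
  classical
  have hbij := isPerfect_iff_bijective_of.mp hperf
  have hdis := (h.forall_common_dvd_eq_one_iff_disjoint_supp hperf a b).mp hno
  obtain ⟨ca, rfl⟩ := hac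
  obtain ⟨cb, hcb⟩ := hbc
  obtain ⟨xa, hxa⟩ := h.factorMap_mem_range (Perfection.of M ca)
  obtain ⟨xb, hxb⟩ := h.factorMap_mem_range (Perfection.of M cb)
  apply (Perfection.of_dvd_of_iff hbij).mp
  refine h.dvd_of_factorMap_mul_eq
    (x := fun 𝔮 => if factorMap M (Perfection.of M a) 𝔮 = 1 then xb 𝔮 else xa 𝔮) ?_
  funext 𝔮
  rw [Pi.mul_apply, pfFactorToRlfFactor_apply, map_mul, h.factorMap_mul, Pi.mul_apply]
  by_cases e : factorMap M (Perfection.of M a) 𝔮 = 1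
  · rw [if_pos e, e, one_mul, hcb, map_mul, h.factorMap_mul, Pi.mul_apply, ← hxb,
      pfFactorToRlfFactor_apply]
  · have hb1 : factorMap M (Perfection.of M b) 𝔮 = 1 := by
      by_contra hb1
      exact Set.disjoint_left.mp hdis e hb1
    rw [if_neg e, hb1, mul_one, map_mul, h.factorMap_mul, Pi.mul_apply, ← hxa,
      pfFactorToRlfFactor_apply]

/-! ### Proposition 4.1 (iv)/(v), the monoid statement -/

/-- **Proposition 4.1 (iv)/(v) in the language of monoids** (FrdI p. 77): in a perfect perf-factorial
monoid, for `x ≠ 0` and any `a`: `x` is primary iff there is a prime `𝔭` such that "for every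
primary element `x' ∉ 𝔭`, `x' ≤ a` if and only if `x' ≤ a + x`" — "by comparing the primary
factorizations of `a`, `a + x`" (Def. 2.4 (i)(c)(d)). [cite: MochizukiFrdI2008, Prop. 4.1 (iv) p.77] -/
theorem IsPerfFactorial.isPrimary_iff_exists_prime_dvd_iff (h : IsPerfFactorial M)
    (hperf : IsPerfect M) (a : M) {x : M} (hx : x ≠ 1) :
    IsPrimary x ↔ ∃ 𝔭 : Primes M, ∀ x' : M, IsPrimary x' → x' ∉ 𝔭.carrier →
      (x' ∣ a ↔ x' ∣ a * x) := by
  classical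
  have hM : IsSharp M := h.isDivisorial.isSharp
  have hbij := isPerfect_iff_bijective_of.mp hperf
  haveI : IsCancelMul M := isIntegral_iff_isCancelMul.mp h.isDivisorial.isPreDivisorial.isIntegral
  have hcan : ∀ u v w : Perfection M, u * w = v * w → u = v := by
    intro u v w huv
    obtain ⟨U, rfl⟩ := hbij.2 u
    obtain ⟨V, rfl⟩ := hbij.2 v
    obtain ⟨W, rfl⟩ := hbij.2 w
    rw [← map_mul, ← map_mul] at huv
    rw [mul_right_cancel (hbij.1 huv)]
  constructor
  · intro hxprim
    refine ⟨Quotient.mk (primarySetoid M) ⟨x, hxprim⟩, fun x' hx' hx'𝔭 => ⟨fun hd => hd.mul_right x, ?_⟩⟩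
    intro hd
    -- the primes of `x`, `x'` in `M^pf` are distinct
    have hox : IsPrimary (Perfection.of M x) := (Perfection.isPrimary_of_iff hM).mpr hxprim
    have hox' : IsPrimary (Perfection.of M x') := (Perfection.isPrimary_of_iff hM).mpr hx'
    let 𝔮 : Primes (Perfection M) := Quotient.mk _ ⟨_, hox⟩
    let 𝔮' : Primes (Perfection M) := Quotient.mk _ ⟨_, hox'⟩
    have hx𝔮 : Perfection.of M x ∈ 𝔮.carrier := mem_carrier_mk_of_isPrimary hox
    have hx'𝔮' : Perfection.of M x' ∈ 𝔮'.carrier := mem_carrier_mk_of_isPrimary hox'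
    have hne : 𝔮 ≠ 𝔮' := by
      intro e
      apply hx'𝔭
      have h1 : Perfection.of M x' ∈ 𝔮.carrier := e ▸ hx'𝔮'
      exact Primes.mem_carrier_of_precsim _ (mem_carrier_mk_of_isPrimary hxprim) hx'.1
        (Perfection.of_precsim_of_iff.mp (𝔮.precsim_of_mem_carrier h1 hx𝔮))
    -- compare factorizations: `x'` has coordinates only at `𝔮'`, where `x` has none
    obtain ⟨w, hw⟩ := map_dvd (Perfection.of M) hd
    obtain ⟨xw, hxw⟩ := h.factorMap_mem_range w
    obtain ⟨xa, hxa⟩ := h.factorMap_mem_range (Perfection.of M a)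
    apply (Perfection.of_dvd_of_iff hbij).mp
    refine h.dvd_of_factorMap_mul_eq (x := fun 𝔮'' => if 𝔮'' = 𝔮' then xw 𝔮'' else xa 𝔮'') ?_
    have hwe : factorMap M (Perfection.of M a) * factorMap M (Perfection.of M x) =
        factorMap M (Perfection.of M x') * pfFactorToRlfFactor M xw := by
      rw [hxw, ← h.factorMap_mul, ← h.factorMap_mul, ← map_mul, hw]
    funext 𝔮''
    rw [Pi.mul_apply, pfFactorToRlfFactor_apply]
    by_cases e : 𝔮'' = 𝔮'
    · rw [if_pos e]
      have h1 := congrFun hwe 𝔮''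
      rw [Pi.mul_apply, Pi.mul_apply, pfFactorToRlfFactor_apply,
        factorMap_apply_of_ne M hx𝔮 (e ▸ hne.symm), mul_one] at h1
      exact h1.symm
    · rw [if_neg e, factorMap_apply_of_ne M hx'𝔮' e, one_mul, ← hxa, pfFactorToRlfFactor_apply]
  · rintro ⟨𝔭, h𝔭⟩
    by_contra hnp
    -- the prime of `M^pf` over `𝔭`
    obtain ⟨⟨p, hp'⟩, hp⟩ := Quotient.exists_rep 𝔭
    have hpc : p ∈ 𝔭.carrier := ⟨hp', hp⟩
    have hop : IsPrimary (Perfection.of M p) := (Perfection.isPrimary_of_iff hM).mpr hp'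
    let 𝔭' : Primes (Perfection M) := Quotient.mk _ ⟨_, hop⟩
    have hp𝔭' : Perfection.of M p ∈ 𝔭'.carrier := mem_carrier_mk_of_isPrimary hop
    have hox1 : Perfection.of M x ≠ 1 := fun e => hx (hbij.1 (by rw [e, map_one]))
    -- `x` has a non-zero coordinate at some prime `𝔮 ≠ 𝔭'` (else `x` would be primary)
    have hq : ∃ 𝔮 : Primes (Perfection M), 𝔮 ≠ 𝔭' ∧ factorMap M (Perfection.of M x) 𝔮 ≠ 1 := by
      by_contra hall
      push Not at hall
      apply hnp
      obtain ⟨x₁, x₂, xx, hxs, hx₁, hx₂⟩ := h.exists_split (Perfection.of M x) 𝔭'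
      have hx₂1 : x₂ = 1 := by
        apply h.factorMap_injective
        rw [h.factorMap_one]
        funext 𝔮''
        by_cases e : 𝔮'' = 𝔭'
        · rw [e, hx₂]; rfl
        · rw [← h.factorMap_apply_of_split_ne xx hxs hx₁ e, hall 𝔮'' e]; rfl
      rw [hx₂1, mul_one] at hxs
      have h1 : Perfection.of M x ≼ Perfection.of M p :=
        h.precsim_of_factorMap_eq_mulSingle hp𝔭' xx (hxs ▸ hx₁)
      exact hp'.of_precsim (Perfection.of_precsim_of_iff.mp h1) hx
    obtain ⟨𝔮, hq𝔭', hq⟩ := hq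
    -- split `a` and `x` at `𝔮`
    obtain ⟨a₁, a₂, xa, has, ha₁, ha₂⟩ := h.exists_split (Perfection.of M a) 𝔮
    obtain ⟨x₁, x₂, xx, hxs, hx₁, hx₂⟩ := h.exists_split (Perfection.of M x) 𝔮
    have hx₁q : factorMap M x₁ 𝔮 ≠ 1 := by
      rw [← h.factorMap_apply_of_split_same hxs hx₂]; exact hq
    have hx₁1 : x₁ ≠ 1 := fun e => hx₁q (by rw [e, h.factorMap_one]; rfl)
    have hx₁c : x₁ ∈ 𝔮.carrier := h.mem_carrier_of_factorMap_eq_mulSingle xx hx₁ hx₁1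
    -- the test element `x' := a₁ x₁`, primary of class `𝔮`
    have hax₁ : factorMap M (a₁ * x₁) = pfFactorToRlfFactor M (Pi.mulSingle 𝔮 (xa * xx)) := by
      rw [h.factorMap_mul, ha₁, hx₁, ← map_mul, Pi.mulSingle_mul]
    have hax1 : a₁ * x₁ ≠ 1 := by
      intro e
      apply hx₁q
      have h1 : factorMap M a₁ 𝔮 * factorMap M x₁ 𝔮 = 1 := by
        rw [← Pi.mul_apply, ← h.factorMap_mul, e, h.factorMap_one]; rfl
      exact (isSharp_realification _).eq_one_of_isUnit _ (IsUnit.of_mul_eq_one _ ((mul_comm _ _).trans h1))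
    have haxc : a₁ * x₁ ∈ 𝔮.carrier := h.mem_carrier_of_factorMap_eq_mulSingle (xa * xx) hax₁ hax1
    obtain ⟨X', hX'⟩ := hbij.2 (a₁ * x₁)
    have hX'prim : IsPrimary X' := (Perfection.isPrimary_of_iff hM).mp (hX'.symm ▸ haxc.1)
    have hX'𝔭 : X' ∉ 𝔭.carrier := by
      intro hmem
      apply hq𝔭'
      have h1 : Perfection.of M X' ∈ 𝔭'.carrier := 𝔭'.mem_carrier_of_precsim hp𝔭'
        (by rw [hX']; exact hax1) (Precsim.map _ (𝔭.precsim_of_mem_carrier hmem hpc))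
      obtain ⟨h2, e2⟩ := h1
      obtain ⟨h3, e3⟩ := (hX' ▸ haxc : Perfection.of M X' ∈ 𝔮.carrier)
      exact e3.symm.trans e2
    have hX'ax : X' ∣ a * x := (Perfection.of_dvd_of_iff hbij).mp (by
      rw [hX', map_mul, ← has, ← hxs]
      exact ⟨a₂ * x₂, by rw [mul_mul_mul_comm]⟩)
    have hX'a : X' ∣ a := (h𝔭 X' hX'prim hX'𝔭).mpr hX'ax
    -- but then `x₁ ∣ a₂`, a `𝔮`-free element
    obtain ⟨w, hw⟩ := map_dvd (Perfection.of M) hX'a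
    rw [hX', ← has] at hw
    have hx₁a₂ : x₁ ∣ a₂ := ⟨w, hcan _ _ a₁ (by
      rw [mul_comm a₂ a₁, hw, mul_comm a₁ x₁, mul_assoc, mul_comm a₁, ← mul_assoc])⟩
    exact h.not_dvd_of_factorMap_apply_eq_one hx₁c ha₂ hx₁a₂

end Perfect

end Literature.AlgebraicGeometry.Frobenioids
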